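import Summits.BirchSwinnertonDyer.Rank1Residual.P2.KrizLiMordellAtTwo
import Summits.BirchSwinnertonDyer.Rank1Residual.P2.KrizLiThirteenTwentyThree
import Summits.BirchSwinnertonDyer.Rank1Residual.P2.ShuZhaiCMBaseTransport
import HarnessLib

/-!
# Cell `bsd-print-cf2` (D-0131 (2) PRINT TIER, leaf CornerF @ `p = 2`), typer ty2 — the (★)-CERTIFIED
# Kriz–Li bases `972d1 : y² = x³ + 36` and `3888s1 : y² = x³ + 48` (`j = 0`, ADDITIVE at `2`,
# `K = ℚ(√−23)`) in the SETTING of Kriz–Li 2019 Thm 5.1 (2), every kernel-checkable hypothesis DISCHARGED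

HONEST FRAMING. Companion of `P2/KrizLiMordellAtTwo.lean` (the generic Tate-algorithm data at `2` for
`y² = x³ + k`), `P2/KrizLiJZeroSetting.lean` (the quadratic field), p3's `P2/KrizLiTwoFortyThree*.lean`
(the PRINTED base `243a1`) and `P2/KrizLiThirteenTwentyThree.lean` (same dictionary). The cell's lit seat
(dossier `run/shared/lean/pub/bsd-print-cf2/DOSSIER.md` §14.4, kit j282459, SageMath; engine of that seat,
NOT a certificate of record, NOT print) found that Assumption (★) of Kriz–Li 2019 Thm 5.1 (2) (tree
`KrizLi2019.thm112_bsdTwo_twist`) holds at `972d1` (type IV* at `2`, `c₂ = 3`) and `3888s1` (type II*,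
`c₂ = 1`) with `K = ℚ(√−23)`, both CM (`j = 0`, `2` INERT in `ℚ(√−3)`), of analytic rank one, ADDITIVE
at `2` — the INERT-BAD quadrant of crux `InertJZeroOfFacts` (stmt-BirchSwinnertonDyer-20671), beside the
Shu–Zhai families of `36a1`/`144a1` (which have `E(ℚ)[2] ≠ 0`; these have `E(ℚ)[2] = 0`). DISCHARGED IN
THE KERNEL per base: global minimality (Kraus certificate, incl. Kraus's test at `2` for `3888s1`);
`E(ℚ)[2] = 0` (no `2`-torsion modulo `13`); from the tree's Tate algorithm at `2`: `ord₂ N = 2`, resp.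
`4`, `c₂` ODD, additive at `2` (so Kriz–Li's Manin clause is LIVE: discharged from an odd Manin constant
of the displayed parametrisation, in turn from Agashe–Ribet–Stein / Cremona BY NAME for an optimal one);
`N ∣ 972`, resp. `3888` (`< 5000`: base `BSD(E,2)` by Creutz–Miller BY NAME) and `N = 3ᵏ·2^{f₂}` with
`f₂` even, whence the sign clause `χ_d(−N) = 1` for `d > 0`, `d ≡ 1 (mod 12)`; a rational point of
infinite order; the Heegner hypothesis K-GENERICALLY (`d_K ≡ 1 (8)`, `(d_K/3) = 1`) and at `d_K = −23`;
the prime support of `2N`; the decidable form of "`a_ℓ` odd"; and the placement of the twists by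
`d ≡ 1 (mod 4)` (CM, `2` inert, NOT good at `2`). No named fact; nothing beyond kernel theorems about two
explicit curves; the leaf is OPEN AS A CLASS; (★) stays the consumer's displayed binder.

References: [KrizLi2019] Thm 5.1 (2), Def 4.1, Thm 4.3, Rem. 6.3; [SilvermanATAEC1994] IV.9.4, Table 4.1, IV.10–11;
[Kraus1989] Prop. 2; [Cremona1997] Table 1 (972d1, 3888s1); [SilvermanAEC2009] VII.1, VII.3.4, VII.5.1, VIII.6.7;
[AgasheRibetStein2006] Thm 2.6; [Marcus1977] Ch. 3 Thm 25; [CreutzMiller2012] Thm 1.1; cell dossier §14.4. -/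

noncomputable section

open scoped Classical

open WeierstrassCurve NumberField Literature.NumberTheory.EllipticCurves
  Literature.NumberTheory.EllipticCurves.Rank1Residual
  Literature.NumberTheory.EllipticCurves.ModularForms
  Summit.BirchSwinnertonDyer.Rank1Residual IsDedekindDomain Rat.HeightOneSpectrum

set_option autoImplicit false

namespace Summit.BirchSwinnertonDyer.Rank1Residual.P2

open Summit.BirchSwinnertonDyer.BirchSwinnertonDyer.Theorems.ConductorBoundOfBadPrimes
  Literature.NumberTheory.EllipticCurves.Rank1Residual.X11RankOneCertificates IsDedekindDomain
  Literature.NumberTheory.DiophantineGeometry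

/-! ## §0 `a_ℓ` parity for a named model of `y² = x³ + k` -/

/-- **`a_ℓ(W)` odd `⟺` `x³ = −k` has an even number of roots mod `ℓ`**, for a globally minimal `W` that IS
the equation `y² = x³ + k` (`k ∈ ℤ`, `ℓ ∤ Δ`). [cite: KrizLi2019, Def. 4.1 and arXiv:1606.03172 p. 14 L57–58] -/
theorem odd_frobeniusTrace_of_eq_sextic_iff (W : WeierstrassCurve ℚ) [W.IsElliptic] [W.IsGloballyMinimal]
    (k : ℤ) (hW : W = ⟨0, 0, 0, 0, (k : ℚ)⟩) {ℓ : ℕ} [NeZero ℓ] (hℓ : ℓ.Prime) (h2 : ℓ ≠ 2)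
    (hΔ : ¬ (ℓ : ℤ) ∣ (⟨0, 0, 0, 0, k⟩ : WeierstrassCurve ℤ).Δ) :
    Odd (W.frobeniusTrace ℓ) ↔ Even ((Finset.univ.filter fun x : ZMod ℓ => x ^ 3 = -(k : ZMod ℓ)).card) := by
  haveI : Fact ℓ.Prime := ⟨hℓ⟩
  have hsm : (1 : VariableChange ℚ) • W = shortWeierstrass (0, k) := by rw [one_smul, hW, shortWeierstrass]; push_cast; rfl
  rw [BSZLemma17.frobeniusTrace_eq_of_smul_eq_shortWeierstrass hsm ℓ (by simpa using hΔ),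
    odd_frobeniusTrace_mordell_iff hℓ h2 (by simpa using hΔ)]

/-! ## §1 `972d1 : y² = x³ + 36` (`N = 972`; Kodaira IV* at `2`, `f₂ = 2`) -/

/-- **Cremona's `972d1 = [0,0,0,0,36]`** (`Δ = −432·36²`; generator `(−3, 3)`; rank `1`; (★)
certified at `K = ℚ(√−23)`, cell dossier §14.4 — NOT printed). [cite: Cremona1997, Table 1 (curve 972d1)] -/
abbrev curve972d1 : WeierstrassCurve ℚ := ⟨0, 0, 0, 0, 36⟩

/-- The integer model of `972d1`. [folklore] -/
def curve972d1Int : WeierstrassCurve ℤ := ⟨0, 0, 0, 0, 36⟩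

/-- The integer model maps to the rational one. [folklore] -/
theorem curve972d1Int_map : curve972d1Int.map (Int.castRingHom ℚ) = curve972d1 := by
  ext <;> simp [curve972d1Int, WeierstrassCurve.map]

/-- `Δ` of the integer model. [folklore] -/
theorem curve972d1Int_Δ : curve972d1Int.Δ = -432 * 36 ^ 2 := by
  simp only [curve972d1Int, WeierstrassCurve.Δ, WeierstrassCurve.b₂, WeierstrassCurve.b₄,
    WeierstrassCurve.b₆, WeierstrassCurve.b₈]; norm_num

/-- `972d1` is literally `⟨0, 0, 0, 0, (36 : ℤ)⟩` cast. [folklore] -/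
theorem curve972d1_eq : curve972d1 = ⟨((0 : ℤ) : ℚ), ((0 : ℤ) : ℚ), ((0 : ℤ) : ℚ), ((0 : ℤ) : ℚ), ((36 : ℤ) : ℚ)⟩ := by
  push_cast; rfl

/-- `972d1` is an elliptic curve. [folklore] -/
instance isElliptic_curve972d1 : curve972d1.IsElliptic := isElliptic_of_j_zero_model (by norm_num)

/-- **`972d1` is globally minimal** (Kraus–Silverman certificate at `2` and `3`). [cite: SilvermanAEC2009, VII.1 Remark 1.1] [cite: Kraus1989, Prop. 2] -/
instance isGloballyMinimal_curve972d1 : curve972d1.IsGloballyMinimal :=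
  X11b.isGloballyMinimal_of_krausCriterion_support 0 0 0 0 36 [(2, 2, 8), (3, 5, 7)]
    (by intro t ht; simp only [List.mem_cons, List.not_mem_nil, or_false] at ht; rcases ht with rfl | rfl <;> norm_num)
    (by decide +kernel) (by decide +kernel)

/-- **`972d1(ℚ)[2] = 0`**: modulo the good prime `13` there is no affine `2`-torsion point (`x³ = −36` has no
root in `𝔽_13`). [cite: KrizLi2019, Thm. 5.1 hypothesis "E(ℚ)[2] = 0"] [cite: SilvermanAEC2009, Prop. VII.3.1(b)] -/
theorem twoTorsion_curve972d1 : ∀ Q : curve972d1.toAffine.Point, 2 • Q = 0 → Q = 0 := by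
  rw [← curve972d1Int_map]
  haveI : Fact (Nat.Prime 13) := ⟨by norm_num⟩
  have hΔ : ¬ ((13 : ℕ) : ℤ) ∣ curve972d1Int.Δ := by rw [curve972d1Int_Δ]; norm_num
  have hB : twoTorsionNoneB curve972d1Int 13 = true := by decide +kernel
  exact fun Q hQ => twoTorsion_eq_zero_of_twoTorsionNoneB curve972d1Int 13 hΔ (by norm_num) hB Q hQ

/-- **At `2`: `ord₂ N(972d1) = 2`, `c₂` odd, additive** (Kodaira IV*; Tate's algorithm in the tree).
[cite: SilvermanATAEC1994, IV.9.4 and Table 4.1] -/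
theorem at_two_curve972d1 :
    haveI : Fact (Nat.Prime 2) := ⟨Nat.prime_two⟩
    (curve972d1.conductorNorm ℤ).factorization 2 = 2 ∧
      Odd ((curve972d1.baseChange ℚ_[2]).localTamagawaNumber ℤ_[2]) ∧
      curve972d1.HasAdditiveReductionAt placeTwo𝓞 ∧ ¬ curve972d1.HasGoodReductionAtPrime 2 ∧
      ¬ curve972d1.HasMultiplicativeReductionAtPrime 2 :=
  krizLi_at_two_mordell_four_mul curve972d1 rfl rfl rfl rfl (u := 9) (by decide) (by push_cast; norm_num)

/-- **`N(972d1) ∣ 972`**: Ogg's bounds `f₂ ≤ 8`, `f₃ ≤ 5` sharpened by the exact `f₂ = 2`.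
[cite: Silverman1994, IV.10.4 and IV.11.1] -/
theorem conductorNorm_curve972d1_dvd : curve972d1.conductorNorm ℤ ∣ 972 := by
  have h : curve972d1.conductorNorm ℤ ∣ 62208 :=
    conductorNorm_dvd_of_localBounds 0 0 0 0 36 curve972d1 curve972d1_eq [(2, 8), (3, 7)]
      (by intro t ht; simp only [List.mem_cons, List.not_mem_nil, or_false] at ht; rcases ht with rfl | rfl <;> norm_num)
      (by decide +kernel) (by norm_num) (by decide +kernel)
  have h' := dvd_three_pow_mul_pow_of_factorization (i := 5) (a := 8) Nat.prime_two
    (by simpa using h) at_two_curve972d1.1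
  simpa using h'

/-- `N(972d1) < 5000` (Creutz–Miller's range). [folklore] -/
theorem conductorNorm_curve972d1_lt : curve972d1.conductorNorm ℤ < 5000 :=
  lt_of_le_of_lt (Nat.le_of_dvd (by norm_num) conductorNorm_curve972d1_dvd) (by norm_num)

/-- `N(972d1) ≠ 0`. [folklore] -/
instance neZero_conductorNorm_curve972d1 : NeZero (curve972d1.conductorNorm ℤ) :=
  ⟨(curve972d1.conductorNorm_pos_holds).ne'⟩

/-- **`N(972d1) = 3ᵏ · 2^2`** for some `k` (Cremona: `N = 972`, not needed). [cite: Cremona1997, Table 1 (972d1)] -/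
theorem conductorNorm_curve972d1_eq : ∃ k, curve972d1.conductorNorm ℤ = 3 ^ k * 2 ^ 2 :=
  eq_three_pow_mul_pow_of_dvd (i := 5) Nat.prime_two (by norm_num) (by simpa using conductorNorm_curve972d1_dvd)
    at_two_curve972d1.1

/-- A prime `ℓ ∉ {2, 3}` does not divide `2N(972d1)`. [folklore] -/
theorem not_dvd_two_mul_conductorNorm_curve972d1 {ℓ : ℕ} (hℓ : ℓ.Prime) (h2 : ℓ ≠ 2) (h3 : ℓ ≠ 3) :
    ¬ ℓ ∣ 2 * curve972d1.conductorNorm ℤ := by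
  intro h
  have h' : ℓ ∣ 2 * 972 := h.trans (mul_dvd_mul_left 2 conductorNorm_curve972d1_dvd)
  have h'' : ℓ ∣ 2 ^ 7 * 3 ^ 5 := h'.trans (by norm_num)
  rcases (Nat.Prime.dvd_mul hℓ).mp h'' with h | h
  · exact h2 ((Nat.prime_dvd_prime_iff_eq hℓ Nat.prime_two).mp (hℓ.dvd_of_dvd_pow h))
  · exact h3 ((Nat.prime_dvd_prime_iff_eq hℓ Nat.prime_three).mp (hℓ.dvd_of_dvd_pow h))

/-- **Kriz–Li's local clause for `972d1`, given an odd Manin constant of the displayed parametrisation.**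
[cite: KrizLi2019, Thm. 5.1 hypotheses "c₂(E) odd; if E has additive reduction at 2, its Manin constant is odd"] -/
theorem krizLi_loc_curve972d1 {N : ℕ} [NeZero N] (Dt : ModularParametrizationData curve972d1 N) (hc : Odd Dt.c) :
    haveI : Fact (2 : ℕ).Prime := ⟨Nat.prime_two⟩
    Odd ((curve972d1.baseChange ℚ_[2]).localTamagawaNumber ℤ_[2]) ∧
      (¬ curve972d1.HasGoodReductionAtPrime 2 → ¬ curve972d1.HasMultiplicativeReductionAtPrime 2 → Odd Dt.c) :=
  krizLi_loc_of_odd curve972d1 Dt at_two_curve972d1.2.1 hc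

/-- **The Manin constant of an OPTIMAL parametrisation of `972d1` is odd** (Agashe–Ribet–Stein / Cremona,
`N ≤ 130000`, BY NAME `hARS`): discharges `hc` of `krizLi_loc_curve972d1` for a displayed optimal datum.
[cite: AgasheRibetStein2006, Thm. 2.6 (Cremona: c_E = 1 for optimal curves of conductor ≤ 130000)] -/
theorem odd_c_of_isOptimalDatum_curve972d1 (hARS : AgasheRibetStein2006.cremona_abs_maninConstant_eq_one_of_level_le)
    (Dt : ModularParametrizationData curve972d1 (curve972d1.conductorNorm ℤ))
    (hopt : ShuZhai2021.IsOptimalDatum curve972d1 Dt) : Odd Dt.c := by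
  have h2 := not_two_dvd_c_of_isOptimalDatum_of_conductorNorm_le hARS Dt hopt
    (conductorNorm_curve972d1_lt.le.trans (by norm_num))
  exact Int.odd_iff.mpr (Int.emod_two_ne_zero.mp fun h0 => h2 (Int.dvd_of_emod_eq_zero h0))

/-- **`1 ≤ rank_ℤ 972d1(ℚ)` IN THE KERNEL**: `3·(−3, 3)` has `x = -1691 / 1521` with the odd prime
`3 ∣ 1521`. [cite: SilvermanAEC2009, VII.3.4 and Thm. VIII.6.7] [cite: Cremona1997, Table 1 (972d1: r = 1)] -/
theorem one_le_mordellWeilRank_curve972d1 : 1 ≤ curve972d1.mordellWeilRank := by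
  haveI : Fact (Nat.Prime 3) := ⟨by norm_num⟩
  exact one_le_mordellWeilRank_of_dvd_den curve972d1 3 (by norm_num) (x := -1691 / 1521) (y := 349055 / 59319)
    (WeierstrassCurve.Affine.equation_iff_nonsingular.mp (by
      rw [WeierstrassCurve.Affine.equation_iff]; norm_num))
    (by norm_num)

/-- **The Heegner hypothesis for `N(972d1)` in ANY quadratic `K` with `d_K ≡ 1 (mod 8)` and `(d_K/3) = 1`**
(`2` and `3`, the primes of `N`, split). [cite: KrizLi2019, Thm. 5.1 hypothesis "K satisfies the Heegner hypothesis for N"] -/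
theorem satisfiesHeegnerHypothesis_curve972d1 {K : Type} [Field K] [NumberField K]
    (h2 : Module.finrank ℚ K = 2) (h8 : NumberField.discr K % 8 = 1) (h3 : jacobiSym (NumberField.discr K) 3 = 1) :
    SatisfiesHeegnerHypothesis (curve972d1.conductorNorm ℤ) K := by
  refine satisfiesHeegnerHypothesis_of_dvd h2 conductorNorm_curve972d1_dvd (fun q hq hqB hq2 => ?_) (fun _ => h8)
  have h'' : q ∣ 2 ^ 6 * 3 ^ 5 := hqB.trans (by norm_num)
  rcases (Nat.Prime.dvd_mul hq).mp h'' with h | h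
  · exact absurd ((Nat.prime_dvd_prime_iff_eq hq Nat.prime_two).mp (hq.dvd_of_dvd_pow h)) hq2
  · rw [(Nat.prime_dvd_prime_iff_eq hq Nat.prime_three).mp (hq.dvd_of_dvd_pow h)]; exact h3

/-- **Heegner hypothesis for `(972d1, K)`, `d_K = −23`.** [cite: KrizLi2019, Thm. 5.1 hypothesis "K satisfies the Heegner hypothesis for N"] [cite: Marcus1977, Ch. 3 Thm. 25] -/
theorem satisfiesHeegnerHypothesis_curve972d1_of_discr_eq {K : Type} [Field K] [NumberField K]
    (h2 : Module.finrank ℚ K = 2) (hdK : NumberField.discr K = -23) :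
    SatisfiesHeegnerHypothesis (curve972d1.conductorNorm ℤ) K :=
  satisfiesHeegnerHypothesis_curve972d1 h2 (by rw [hdK]; decide) (by rw [hdK]; norm_num)

/-- **`a_ℓ(972d1)` odd `⟺` an even number of cube roots of `-36` in `𝔽_ℓ`** (`ℓ ∉ {2,3}`).
[cite: KrizLi2019, Def. 4.1 ("Frob_ℓ of order 3", a_ℓ odd)] -/
theorem odd_frobeniusTrace_curve972d1_iff {ℓ : ℕ} [NeZero ℓ] (hℓ : ℓ.Prime) (h2 : ℓ ≠ 2) (h3 : ℓ ≠ 3) :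
    Odd (curve972d1.frobeniusTrace ℓ) ↔ Even ((Finset.univ.filter fun x : ZMod ℓ => x ^ 3 = -36).card) := by
  have hk : ¬ (ℓ : ℤ) ∣ 36 := by
    intro h
    have hℓp : Prime (ℓ : ℤ) := Nat.prime_iff_prime_int.mp hℓ
    have h' : (ℓ : ℤ) ∣ 2 ^ 4 * 3 ^ 2 := h.trans (by norm_num)
    rcases hℓp.dvd_or_dvd h' with h | h
    · exact h2 ((Nat.prime_dvd_prime_iff_eq hℓ Nat.prime_two).mp
        (Int.natCast_dvd_natCast.mp (by exact_mod_cast hℓp.dvd_of_dvd_pow h)))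
    · exact h3 ((Nat.prime_dvd_prime_iff_eq hℓ Nat.prime_three).mp
        (Int.natCast_dvd_natCast.mp (by exact_mod_cast hℓp.dvd_of_dvd_pow h)))
  have h := odd_frobeniusTrace_of_eq_sextic_iff curve972d1 36 (by push_cast; rfl) hℓ h2
    (not_dvd_Δ_sexticInt hℓ h2 h3 hk)
  push_cast at h
  simpa using h

/-- **The sign clause `χ_d(−N) = 1` for `972d1`** for positive `d ≡ 1 (mod 12)` (`N = 3ᵏ·2^2`, `f₂` even).
[cite: KrizLi2019, Thm. 5.1 (2) condition "χ_d(−N) = 1"] -/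
theorem sign_mul_jacobiSym_conductorNorm_curve972d1 {d : ℤ} (hd0 : 0 < d) (hd12 : d % 12 = 1) :
    Int.sign d * jacobiSym (curve972d1.conductorNorm ℤ) d.natAbs = 1 := by
  obtain ⟨k, hk⟩ := conductorNorm_curve972d1_eq
  exact sign_mul_jacobiSym_eq_one_of_eq_three_pow_mul_two_pow (k := k) (m := 1) (hk.trans (by norm_num)) hd0 hd12

/-- **The twists of `972d1` by `d ≡ 1 (mod 4)` are ADDITIVE at `2` on every model** (`y² = x³ + 36d³`
has the same `2`-adic shape as the base): the family lies in the INERT-BAD quadrant; with CM and `2` inert.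
[cite: SilvermanATAEC1994, IV.9.4] [cite: Cox2013, §5.B Prop. 5.16] -/
theorem placement_of_smul_twist_curve972d1 {d : ℤ} (hd4 : d % 4 = 1) {W : WeierstrassCurve ℚ} [W.IsElliptic]
    {C : VariableChange ℚ} (hC : C • curve972d1.quadraticTwist (d : ℚ) = W) :
    W.HasCM ∧ CMInert W 2 ∧ ¬ Good W 2 := by
  have hd0 : (d : ℚ) ≠ 0 := by exact_mod_cast (show d ≠ 0 by omega)
  obtain ⟨hcm, hin⟩ := hasCM_and_cmInert_two_of_smul_twist_sextic (k := 36) (by norm_num) hd0 hC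
  refine ⟨hcm, hin, not_good_two_of_smul_twist_sextic hC ?_⟩
  haveI : (⟨0, 0, 0, 0, (d : ℚ) ^ 3 * 36⟩ : WeierstrassCurve ℚ).IsElliptic :=
    isElliptic_of_j_zero_model (mul_ne_zero (pow_ne_zero 3 hd0) (by norm_num))
  exact (krizLi_at_two_mordell_four_mul ⟨0, 0, 0, 0, (d : ℚ) ^ 3 * 36⟩ rfl rfl rfl rfl (u := 9 * d ^ 3)
    (by exact Int.ModEq.mul_left 9 ((show d ≡ 1 [ZMOD 4] by simpa [Int.ModEq] using hd4).pow 3)) (by push_cast; ring)).2.2.2.1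

/-! ## §2 `3888s1 : y² = x³ + 48` (`N = 3888`; Kodaira II* at `2`, `f₂ = 4`) -/

/-- **Cremona's `3888s1 = [0,0,0,0,48]`** (`Δ = −432·48²`; generator `(1, 7)`; rank `1`; (★)
certified at `K = ℚ(√−23)`, cell dossier §14.4 — NOT printed). [cite: Cremona1997, Table 1 (curve 3888s1)] -/
abbrev curve3888s1 : WeierstrassCurve ℚ := ⟨0, 0, 0, 0, 48⟩

/-- The integer model of `3888s1`. [folklore] -/
def curve3888s1Int : WeierstrassCurve ℤ := ⟨0, 0, 0, 0, 48⟩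

/-- The integer model maps to the rational one. [folklore] -/
theorem curve3888s1Int_map : curve3888s1Int.map (Int.castRingHom ℚ) = curve3888s1 := by
  ext <;> simp [curve3888s1Int, WeierstrassCurve.map]

/-- `Δ` of the integer model. [folklore] -/
theorem curve3888s1Int_Δ : curve3888s1Int.Δ = -432 * 48 ^ 2 := by
  simp only [curve3888s1Int, WeierstrassCurve.Δ, WeierstrassCurve.b₂, WeierstrassCurve.b₄,
    WeierstrassCurve.b₆, WeierstrassCurve.b₈]; norm_num

/-- `3888s1` is literally `⟨0, 0, 0, 0, (48 : ℤ)⟩` cast. [folklore] -/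
theorem curve3888s1_eq : curve3888s1 = ⟨((0 : ℤ) : ℚ), ((0 : ℤ) : ℚ), ((0 : ℤ) : ℚ), ((0 : ℤ) : ℚ), ((48 : ℤ) : ℚ)⟩ := by
  push_cast; rfl

/-- `3888s1` is an elliptic curve. [folklore] -/
instance isElliptic_curve3888s1 : curve3888s1.IsElliptic := isElliptic_of_j_zero_model (by norm_num)

/-- **`3888s1` is globally minimal** (Kraus–Silverman certificate at `2` and `3`). [cite: SilvermanAEC2009, VII.1 Remark 1.1] [cite: Kraus1989, Prop. 2] -/
instance isGloballyMinimal_curve3888s1 : curve3888s1.IsGloballyMinimal :=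
  X11b.isGloballyMinimal_of_krausCriterion_support 0 0 0 0 48 [(2, 4, 12), (3, 5, 5)]
    (by intro t ht; simp only [List.mem_cons, List.not_mem_nil, or_false] at ht; rcases ht with rfl | rfl <;> norm_num)
    (by decide +kernel) (by decide +kernel)

/-- **`3888s1(ℚ)[2] = 0`**: modulo the good prime `13` there is no affine `2`-torsion point (`x³ = −48` has no
root in `𝔽_13`). [cite: KrizLi2019, Thm. 5.1 hypothesis "E(ℚ)[2] = 0"] [cite: SilvermanAEC2009, Prop. VII.3.1(b)] -/
theorem twoTorsion_curve3888s1 : ∀ Q : curve3888s1.toAffine.Point, 2 • Q = 0 → Q = 0 := by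
  rw [← curve3888s1Int_map]
  haveI : Fact (Nat.Prime 13) := ⟨by norm_num⟩
  have hΔ : ¬ ((13 : ℕ) : ℤ) ∣ curve3888s1Int.Δ := by rw [curve3888s1Int_Δ]; norm_num
  have hB : twoTorsionNoneB curve3888s1Int 13 = true := by decide +kernel
  exact fun Q hQ => twoTorsion_eq_zero_of_twoTorsionNoneB curve3888s1Int 13 hΔ (by norm_num) hB Q hQ

/-- **At `2`: `ord₂ N(3888s1) = 4`, `c₂` odd, additive** (Kodaira II*; Tate's algorithm in the tree).
[cite: SilvermanATAEC1994, IV.9.4 and Table 4.1] -/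
theorem at_two_curve3888s1 :
    haveI : Fact (Nat.Prime 2) := ⟨Nat.prime_two⟩
    (curve3888s1.conductorNorm ℤ).factorization 2 = 4 ∧
      Odd ((curve3888s1.baseChange ℚ_[2]).localTamagawaNumber ℤ_[2]) ∧
      curve3888s1.HasAdditiveReductionAt placeTwo𝓞 ∧ ¬ curve3888s1.HasGoodReductionAtPrime 2 ∧
      ¬ curve3888s1.HasMultiplicativeReductionAtPrime 2 :=
  krizLi_at_two_mordell_sixteen_mul curve3888s1 rfl rfl rfl rfl (u := 3) (by decide) (by push_cast; norm_num)

/-- **`N(3888s1) ∣ 3888`**: Ogg's bounds `f₂ ≤ 8`, `f₃ ≤ 5` sharpened by the exact `f₂ = 4`.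
[cite: Silverman1994, IV.10.4 and IV.11.1] -/
theorem conductorNorm_curve3888s1_dvd : curve3888s1.conductorNorm ℤ ∣ 3888 := by
  have h : curve3888s1.conductorNorm ℤ ∣ 62208 :=
    conductorNorm_dvd_of_localBounds 0 0 0 0 48 curve3888s1 curve3888s1_eq [(2, 12), (3, 5)]
      (by intro t ht; simp only [List.mem_cons, List.not_mem_nil, or_false] at ht; rcases ht with rfl | rfl <;> norm_num)
      (by decide +kernel) (by norm_num) (by decide +kernel)
  have h' := dvd_three_pow_mul_pow_of_factorization (i := 5) (a := 8) Nat.prime_two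
    (by simpa using h) at_two_curve3888s1.1
  simpa using h'

/-- `N(3888s1) < 5000` (Creutz–Miller's range). [folklore] -/
theorem conductorNorm_curve3888s1_lt : curve3888s1.conductorNorm ℤ < 5000 :=
  lt_of_le_of_lt (Nat.le_of_dvd (by norm_num) conductorNorm_curve3888s1_dvd) (by norm_num)

/-- `N(3888s1) ≠ 0`. [folklore] -/
instance neZero_conductorNorm_curve3888s1 : NeZero (curve3888s1.conductorNorm ℤ) :=
  ⟨(curve3888s1.conductorNorm_pos_holds).ne'⟩

/-- **`N(3888s1) = 3ᵏ · 2^4`** for some `k` (Cremona: `N = 3888`, not needed). [cite: Cremona1997, Table 1 (3888s1)] -/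
theorem conductorNorm_curve3888s1_eq : ∃ k, curve3888s1.conductorNorm ℤ = 3 ^ k * 2 ^ 4 :=
  eq_three_pow_mul_pow_of_dvd (i := 5) Nat.prime_two (by norm_num) (by simpa using conductorNorm_curve3888s1_dvd)
    at_two_curve3888s1.1

/-- A prime `ℓ ∉ {2, 3}` does not divide `2N(3888s1)`. [folklore] -/
theorem not_dvd_two_mul_conductorNorm_curve3888s1 {ℓ : ℕ} (hℓ : ℓ.Prime) (h2 : ℓ ≠ 2) (h3 : ℓ ≠ 3) :
    ¬ ℓ ∣ 2 * curve3888s1.conductorNorm ℤ := by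
  intro h
  have h' : ℓ ∣ 2 * 3888 := h.trans (mul_dvd_mul_left 2 conductorNorm_curve3888s1_dvd)
  have h'' : ℓ ∣ 2 ^ 7 * 3 ^ 5 := h'.trans (by norm_num)
  rcases (Nat.Prime.dvd_mul hℓ).mp h'' with h | h
  · exact h2 ((Nat.prime_dvd_prime_iff_eq hℓ Nat.prime_two).mp (hℓ.dvd_of_dvd_pow h))
  · exact h3 ((Nat.prime_dvd_prime_iff_eq hℓ Nat.prime_three).mp (hℓ.dvd_of_dvd_pow h))

/-- **Kriz–Li's local clause for `3888s1`, given an odd Manin constant of the displayed parametrisation.**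
[cite: KrizLi2019, Thm. 5.1 hypotheses "c₂(E) odd; if E has additive reduction at 2, its Manin constant is odd"] -/
theorem krizLi_loc_curve3888s1 {N : ℕ} [NeZero N] (Dt : ModularParametrizationData curve3888s1 N) (hc : Odd Dt.c) :
    haveI : Fact (2 : ℕ).Prime := ⟨Nat.prime_two⟩
    Odd ((curve3888s1.baseChange ℚ_[2]).localTamagawaNumber ℤ_[2]) ∧
      (¬ curve3888s1.HasGoodReductionAtPrime 2 → ¬ curve3888s1.HasMultiplicativeReductionAtPrime 2 → Odd Dt.c) :=
  krizLi_loc_of_odd curve3888s1 Dt at_two_curve3888s1.2.1 hc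

/-- **The Manin constant of an OPTIMAL parametrisation of `3888s1` is odd** (Agashe–Ribet–Stein / Cremona,
`N ≤ 130000`, BY NAME `hARS`): discharges `hc` of `krizLi_loc_curve3888s1` for a displayed optimal datum.
[cite: AgasheRibetStein2006, Thm. 2.6 (Cremona: c_E = 1 for optimal curves of conductor ≤ 130000)] -/
theorem odd_c_of_isOptimalDatum_curve3888s1 (hARS : AgasheRibetStein2006.cremona_abs_maninConstant_eq_one_of_level_le)
    (Dt : ModularParametrizationData curve3888s1 (curve3888s1.conductorNorm ℤ))
    (hopt : ShuZhai2021.IsOptimalDatum curve3888s1 Dt) : Odd Dt.c := by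
  have h2 := not_two_dvd_c_of_isOptimalDatum_of_conductorNorm_le hARS Dt hopt
    (conductorNorm_curve3888s1_lt.le.trans (by norm_num))
  exact Int.odd_iff.mpr (Int.emod_two_ne_zero.mp fun h0 => h2 (Int.dvd_of_emod_eq_zero h0))

/-- **`1 ≤ rank_ℤ 3888s1(ℚ)` IN THE KERNEL**: `2·(1, 7)` has `x = -383 / 196` with the odd prime
`7 ∣ 196`. [cite: SilvermanAEC2009, VII.3.4 and Thm. VIII.6.7] [cite: Cremona1997, Table 1 (3888s1: r = 1)] -/
theorem one_le_mordellWeilRank_curve3888s1 : 1 ≤ curve3888s1.mordellWeilRank := by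
  haveI : Fact (Nat.Prime 7) := ⟨by norm_num⟩
  exact one_le_mordellWeilRank_of_dvd_den curve3888s1 7 (by norm_num) (x := -383 / 196) (y := -17471 / 2744)
    (WeierstrassCurve.Affine.equation_iff_nonsingular.mp (by
      rw [WeierstrassCurve.Affine.equation_iff]; norm_num))
    (by norm_num)

/-- **The Heegner hypothesis for `N(3888s1)` in ANY quadratic `K` with `d_K ≡ 1 (mod 8)` and `(d_K/3) = 1`**
(`2` and `3`, the primes of `N`, split). [cite: KrizLi2019, Thm. 5.1 hypothesis "K satisfies the Heegner hypothesis for N"] -/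
theorem satisfiesHeegnerHypothesis_curve3888s1 {K : Type} [Field K] [NumberField K]
    (h2 : Module.finrank ℚ K = 2) (h8 : NumberField.discr K % 8 = 1) (h3 : jacobiSym (NumberField.discr K) 3 = 1) :
    SatisfiesHeegnerHypothesis (curve3888s1.conductorNorm ℤ) K := by
  refine satisfiesHeegnerHypothesis_of_dvd h2 conductorNorm_curve3888s1_dvd (fun q hq hqB hq2 => ?_) (fun _ => h8)
  have h'' : q ∣ 2 ^ 6 * 3 ^ 5 := hqB.trans (by norm_num)
  rcases (Nat.Prime.dvd_mul hq).mp h'' with h | h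
  · exact absurd ((Nat.prime_dvd_prime_iff_eq hq Nat.prime_two).mp (hq.dvd_of_dvd_pow h)) hq2
  · rw [(Nat.prime_dvd_prime_iff_eq hq Nat.prime_three).mp (hq.dvd_of_dvd_pow h)]; exact h3

/-- **Heegner hypothesis for `(3888s1, K)`, `d_K = −23`.** [cite: KrizLi2019, Thm. 5.1 hypothesis "K satisfies the Heegner hypothesis for N"] [cite: Marcus1977, Ch. 3 Thm. 25] -/
theorem satisfiesHeegnerHypothesis_curve3888s1_of_discr_eq {K : Type} [Field K] [NumberField K]
    (h2 : Module.finrank ℚ K = 2) (hdK : NumberField.discr K = -23) :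
    SatisfiesHeegnerHypothesis (curve3888s1.conductorNorm ℤ) K :=
  satisfiesHeegnerHypothesis_curve3888s1 h2 (by rw [hdK]; decide) (by rw [hdK]; norm_num)

/-- **`a_ℓ(3888s1)` odd `⟺` an even number of cube roots of `-48` in `𝔽_ℓ`** (`ℓ ∉ {2,3}`).
[cite: KrizLi2019, Def. 4.1 ("Frob_ℓ of order 3", a_ℓ odd)] -/
theorem odd_frobeniusTrace_curve3888s1_iff {ℓ : ℕ} [NeZero ℓ] (hℓ : ℓ.Prime) (h2 : ℓ ≠ 2) (h3 : ℓ ≠ 3) :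
    Odd (curve3888s1.frobeniusTrace ℓ) ↔ Even ((Finset.univ.filter fun x : ZMod ℓ => x ^ 3 = -48).card) := by
  have hk : ¬ (ℓ : ℤ) ∣ 48 := by
    intro h
    have hℓp : Prime (ℓ : ℤ) := Nat.prime_iff_prime_int.mp hℓ
    have h' : (ℓ : ℤ) ∣ 2 ^ 4 * 3 ^ 2 := h.trans (by norm_num)
    rcases hℓp.dvd_or_dvd h' with h | h
    · exact h2 ((Nat.prime_dvd_prime_iff_eq hℓ Nat.prime_two).mp
        (Int.natCast_dvd_natCast.mp (by exact_mod_cast hℓp.dvd_of_dvd_pow h)))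
    · exact h3 ((Nat.prime_dvd_prime_iff_eq hℓ Nat.prime_three).mp
        (Int.natCast_dvd_natCast.mp (by exact_mod_cast hℓp.dvd_of_dvd_pow h)))
  have h := odd_frobeniusTrace_of_eq_sextic_iff curve3888s1 48 (by push_cast; rfl) hℓ h2
    (not_dvd_Δ_sexticInt hℓ h2 h3 hk)
  push_cast at h
  simpa using h

/-- **The sign clause `χ_d(−N) = 1` for `3888s1`** for positive `d ≡ 1 (mod 12)` (`N = 3ᵏ·2^4`, `f₂` even).
[cite: KrizLi2019, Thm. 5.1 (2) condition "χ_d(−N) = 1"] -/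
theorem sign_mul_jacobiSym_conductorNorm_curve3888s1 {d : ℤ} (hd0 : 0 < d) (hd12 : d % 12 = 1) :
    Int.sign d * jacobiSym (curve3888s1.conductorNorm ℤ) d.natAbs = 1 := by
  obtain ⟨k, hk⟩ := conductorNorm_curve3888s1_eq
  exact sign_mul_jacobiSym_eq_one_of_eq_three_pow_mul_two_pow (k := k) (m := 2) (hk.trans (by norm_num)) hd0 hd12

/-- **The twists of `3888s1` by `d ≡ 1 (mod 4)` are ADDITIVE at `2` on every model** (`y² = x³ + 48d³`
has the same `2`-adic shape as the base): the family lies in the INERT-BAD quadrant; with CM and `2` inert.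
[cite: SilvermanATAEC1994, IV.9.4] [cite: Cox2013, §5.B Prop. 5.16] -/
theorem placement_of_smul_twist_curve3888s1 {d : ℤ} (hd4 : d % 4 = 1) {W : WeierstrassCurve ℚ} [W.IsElliptic]
    {C : VariableChange ℚ} (hC : C • curve3888s1.quadraticTwist (d : ℚ) = W) :
    W.HasCM ∧ CMInert W 2 ∧ ¬ Good W 2 := by
  have hd0 : (d : ℚ) ≠ 0 := by exact_mod_cast (show d ≠ 0 by omega)
  obtain ⟨hcm, hin⟩ := hasCM_and_cmInert_two_of_smul_twist_sextic (k := 48) (by norm_num) hd0 hC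
  refine ⟨hcm, hin, not_good_two_of_smul_twist_sextic hC ?_⟩
  haveI : (⟨0, 0, 0, 0, (d : ℚ) ^ 3 * 48⟩ : WeierstrassCurve ℚ).IsElliptic :=
    isElliptic_of_j_zero_model (mul_ne_zero (pow_ne_zero 3 hd0) (by norm_num))
  exact (krizLi_at_two_mordell_sixteen_mul ⟨0, 0, 0, 0, (d : ℚ) ^ 3 * 48⟩ rfl rfl rfl rfl (u := 3 * d ^ 3)
    (by exact Int.ModEq.mul_left 3 ((show d ≡ 1 [ZMOD 4] by simpa [Int.ModEq] using hd4).pow 3)) (by push_cast; ring)).2.2.2.1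

end Summit.BirchSwinnertonDyer.Rank1Residual.P2
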